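import Summits.QuantumFields.BalabanUV.Beta.SymRootedT2JetSingle
import Summits.QuantumFields.BalabanUV.Beta.SymAveragingMixedJetTables
import Summits.QuantumFields.BalabanUV.Beta.SymAveragingHessianCounts
import Summits.QuantumFields.BalabanUV.Beta.RootedBorderTableLaw

/-!
# `BalabanUV.Beta.SymRootedBorderTableLaw` — THE BOND-LEVEL REFLECTION LAW OF THE (0.4)-SYMMETRISED BORDER TABLE `symVh2Tab`, KERNEL `symVh2KerAt`,
# AT ROOT `ctr 4 Lc`, FOR EVERY ODD `Lc` (β sub-cell, row D1, TABLES-SYM-LEAN S2c∕S2d, TABLE∕KERNEL-LEVEL twin of the row owner's MX4-B `RootedBorderTableLaw`;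
# an1 gen 43; the border REFLECTION path toward the sym root's border letters)

HONEST FRAMING (cell charter, verbatim): «discharging BetaPertH makes Bałaban's UV stability UNCONDITIONAL — a real
constructive-QFT result; it is NOT the continuum limit and NOT the Clay problem.»  HONEST DEPENDENCY (verbatim): «continuum YM on
T⁴ ⇐ BetaPertH ∧ nine spine estimates (0/9 proved); BetaPertH ⇐ (D1) ∧ (D4) ∧ CAP+tail; G-an2-4 gates asym, D1 and NE2/3/4.»
ABSOLUTE RULE (R-g25-7 ∕ R-D1-g30-1 (A)): the (0.4)-symmetrised averaging is the exp of the MEAN OF LOGS over the pair family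
`{loop^{σ,σ′}}` with weight `((d!)²·L^d)⁻¹`; every object below is the comb module's algebra read on an1's `symPhiGAt` (S2b part 1)
instead of `PhiGAt` — STATEMENT FOR STATEMENT under the dictionary `PhiXAt ↦ symPhiXAt`, `XjetAt ↦ symXjetAt`, `MσXAt ↦ symMσXAt`,
`L^{-d}·linAvgAt ↦ (d!·L^d)⁻¹·symLinU`, `L^{-d}·hessUAt ↦ ((d!)²L^d)⁻¹·symHessUAt`, `L^{-2d}·vhUAt ↦ ((d!)²L^{2d})⁻¹·symVhUAt`
(an3-g63 [AN3-G63-S2C] (C-ii): constants PER BCH ORDER; CONVENTION `(d!)²` un-normalised inside order-2 sym functionals).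
FAMILY-INDEPENDENT chart ∕ letter ∕ `Tau`-algebra lemmas of the comb module are imported BY NAME, never re-proved.
DERIVED cell leaf: [folklore] ring algebra; the `sym*` families are [our object]s.  No statement of Bałaban's papers is typed here, no
`[cite:]` tag, no `Prop` is minted, no binder of the β-function wall (`hW`/`hR`/`D1Tel`/`D1Rep`, (D1), `BetaPertH`) is instantiated or
discharged; nothing about the VALUES of `symMixFFAt`∕`symVh₂SAt` and no (T2-B)∕(T2-M₂) letter is discharged in this file.
NOT D1, NOT BetaPertH, NOT continuum, NOT Clay.  NOT summit progress.
Provenance: β sub-cell, TABLES-SYM-LEAN S2c option (C) (S2C-SCOPE-v1 94facb80ac685517), unit b2b-balaban-beta-an1-g43 (W-supplier AN1,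
FREEZE (0): scratch for a courier; an1 files nothing), 2026-08-21; no existing file touched.

## What this module proves (sym twin of `RootedBorderTableLaw` §2–§4; §1's `E`-letter lemmas and `contact_iff'` are the comb module's BY NAME; §5's corollaries
## concern the COMB literals `JsRowD1`∕`JsRowD1Pin` and are NOT twinned)
* §2 **the pieces at the letters `E₂₃` (fluctuation), `E₀₁`, `E₁₂` (backgrounds)**: `c10_symNR_E c01_symNR_E c11_symNR_E c11_symNR_E' X00_E X01_E X10_E X01_E' X10_E'
  symCT_entry symCT_entry' symCJ_entry symCJ_entry'` — an1's `SymRootedT2JetSingle` components written as scalars • one letter, constants per BCH order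
  (`L^{-d} ↦ (d!·L^d)⁻¹`, `(2L^d)⁻¹ ↦ (2(d!)²L^d)⁻¹`, `(2L^{2d})⁻¹ ↦ (2(d!)²L^{2d})⁻¹`, in-bracket contact `[G=H]·q ↦ [G=H]·d!·q_sym`).
* §3 **`symVh2Tab_bref`** (`L` odd, general `d`, root `ctr d L`): the per-ordering ℚ reflection law of the sym border table —
  `s_sym_{(μ, bref α μ y)}(f; g, h) = ε_μ ς_f ς_g ς_h · (s_sym_{(μ,y)}(f♯; g♯, h♯) − ((d!)²L^{2d})⁻¹ χ_HF v_sym(f♯,g♯) + (d!L^d)⁻¹ χ_GF χ_HF q_sym(f♯)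
  + [μ = α]·((d!L^d)⁻³ q_sym(g♯) v_sym(f♯,h♯) − 2(d!L^d)⁻² χ_HF q_sym(f♯) q_sym(g♯) − (d!)⁻³L^{-2d} q_sym(f♯) h_sym(g♯,h♯) + (d!L^d)⁻³ q_sym(f♯) q_sym(g♯) q_sym(h♯)))`.
* §4 **`symBondLaw`** (`Lc` odd, `d = 4`, root `ctr 4 Lc`): the `(g,h)`-SYMMETRISED bond-level border reflection law IN KERNEL CURRENCY — the SAME outer shape as the
  comb `bondLaw` (MX4-B §4 ∕ RX's `hBb`) with `symVh2KerAt symVhKerAt symLinKerAt` for `vh2KerAt vhKerAt linKerAt` (the `d!`-factors sit inside the sym kernels).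
-/

namespace Summit.QuantumFields.BalabanUV.Beta.SymRootedBorderTableLaw

open Literature.MathematicalPhysics.QuantumFieldTheory.Balaban1983to89
open Literature.MathematicalPhysics.QuantumFieldTheory.Balaban1983to89.Beta
open scoped Nat
open AffineAveraging (Form1 toSite)
open AveragingContoursRooted (ctr ctrOff)
open AveragingHessianKernels (Bond single)
open Summit.QuantumFields.BalabanUV.Beta.SymAveragingHessianCounts (symLinCountAt symHessCountAt symVhCountAt symHessCountAt_swap symHessCountAt_self symVhKerAt symLinKerAt)
open AveragingThirdJet (upF)
open AveragingThirdJet.Tau (c00 c10 c01 c11)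
open AveragingMixedJetTables (UT E)
open Summit.QuantumFields.BalabanUV.Beta.SymAveragingMixedJetTables (symQjetAt symT2At symVh2Tab symVh2KerAt)
open PolarizationSign (reflSign AxisReflectionCovariant)
open ResolventReflection (bref bref_bref)
open RootedKernelReflection (fref fref_fst fref_injective)
open OneStepKernelFamily (TbalOf flipK)
open Summit.QuantumFields.BalabanUV.Beta.RowD1JointEnd (JsRowD1 JsRowD1Pin)
open Summit.QuantumFields.BalabanUV.Beta.RootedHolonomyReflection (R1g)
open Summit.QuantumFields.BalabanUV.Beta.RootedJetReflectionExpanded (ad1R)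
open Summit.QuantumFields.BalabanUV.Beta.SymRootedT2JetReflection (symCT symNR symCJ)
open Summit.QuantumFields.BalabanUV.Beta.RootedT2JetDictionary (R1g_upF)
open Summit.QuantumFields.BalabanUV.Beta.RootedMixedTableLaw (fref_mk)
open Summit.QuantumFields.BalabanUV.Beta.SymRootedT2JetSingle (symT2At_bref symCT_of_single c10_symNR_of_single c01_symNR_of_single c11_symNR_of_single
  X00_of_single X01_of_single X10_of_single symT2At_upF_single_signs)
open Summit.QuantumFields.BalabanUV.Beta.RootedT2JetSingle (R1g_single_signed)
open Summit.QuantumFields.BalabanUV.Beta.RootedBorderTableLaw (comm_E01_E23 comm_E23_E01 comm_E12_E23 comm_E23_E12 comm_E01_E12 comm_E12_E01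
  E01_mul_E12 E12_mul_E01 contact_iff')

/-! ## §1 The letters: `UT` algebra, the comb module's `comm_E01_E23 … E12_mul_E01` BY NAME -/

/-! ## §2 Components and their `(0,3)` entries -/

section Pieces

variable {d L : ℕ} (hL : (L : ℚ) ≠ 0) (ρ : Fin d → ℤ) {α : Fin d} {W B B' : Form1 d UT} {F G H : Bond d}
include hL

/-- [folklore] `c10 symNR = (ℓ⁻¹ Z_G) • P` at a single first background letter `P` (an1's `c10_symNR_of_single`). -/
theorem c10_symNR_E {P : UT} (hB : R1g α B = single G P) (B' : Form1 d UT) (μ : Fin d) (y : Fin d → ℤ) :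
    c10 (symNR ℚ ρ α B B' L μ y) = (((d ! : ℚ) * (L : ℚ) ^ d)⁻¹ * symLinCountAt ρ L μ y G) • P := by
  rw [c10_symNR_of_single (Nat.cast_ne_zero.2 (Nat.factorial_ne_zero d)) hL ρ hB B' μ y, ← Int.cast_smul_eq_zsmul ℚ, smul_smul]

/-- [folklore] `c01 symNR = (ℓ⁻¹ Z_H) • Q` at a single second background letter `Q` (an1's `c01_symNR_of_single`). -/
theorem c01_symNR_E {Q : UT} (hB' : R1g α B' = single H Q) (B : Form1 d UT) (μ : Fin d) (y : Fin d → ℤ) :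
    c01 (symNR ℚ ρ α B B' L μ y) = (((d ! : ℚ) * (L : ℚ) ^ d)⁻¹ * symLinCountAt ρ L μ y H) • Q := by
  rw [c01_symNR_of_single (Nat.cast_ne_zero.2 (Nat.factorial_ne_zero d)) hL ρ hB' B μ y, ← Int.cast_smul_eq_zsmul ℚ, smul_smul]

/-- [folklore] `c11 symNR(B,B′) = ν • E₀₂` for the letters `E₀₁` on `G`, `E₁₂` on `H` (an1's `c11_symNR_of_single`, §1). -/
theorem c11_symNR_E (hB : R1g α B = single G (E 0 1)) (hB' : R1g α B' = single H (E 1 2)) (μ : Fin d) (y : Fin d → ℤ) :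
    c11 (symNR ℚ ρ α B B' L μ y)
      = (((2 : ℚ) * ((d ! : ℚ) ^ 2 * (L : ℚ) ^ d))⁻¹ * (symHessCountAt ρ L μ y G H + (if G = H then (1 : ℚ) else 0) * ((d ! : ℚ) * symLinCountAt ρ L μ y G))
          - ((d ! : ℚ) * (L : ℚ) ^ d)⁻¹ * ((if G = H ∧ G.1 = α then (1 : ℚ) else 0) * symLinCountAt ρ L μ y G)
          + ((2 : ℚ) * ((d ! : ℚ) ^ 2 * (L : ℚ) ^ (2 * d)))⁻¹ * (symLinCountAt ρ L μ y G * symLinCountAt ρ L μ y H)) • E 0 2 := by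
  rw [c11_symNR_of_single (Nat.cast_ne_zero.2 (Nat.factorial_ne_zero d)) hL two_ne_zero ρ hB hB' μ y, comm_E01_E12, comm_E12_E01]
  simp only [← Int.cast_smul_eq_zsmul ℚ, smul_mul_assoc, mul_smul_comm, E01_mul_E12, E12_mul_E01, smul_zero, add_zero]
  by_cases hGH : G = H
  · by_cases hGa : G.1 = α
    · simp only [if_pos hGH, if_pos (show G = H ∧ G.1 = α from ⟨hGH, hGa⟩)]
      module
    · simp only [if_pos hGH, if_neg (show ¬(G = H ∧ G.1 = α) from fun h => hGa h.2)]
      module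
  · simp only [if_neg hGH, if_neg (show ¬(G = H ∧ G.1 = α) from fun h => hGH h.1)]
    module

/-- [folklore] `c11 symNR(B′,B) = ν′ • E₀₂` for the same letters, backgrounds in the other order. -/
theorem c11_symNR_E' (hB : R1g α B = single G (E 0 1)) (hB' : R1g α B' = single H (E 1 2)) (μ : Fin d) (y : Fin d → ℤ) :
    c11 (symNR ℚ ρ α B' B L μ y)
      = (-(((2 : ℚ) * ((d ! : ℚ) ^ 2 * (L : ℚ) ^ d))⁻¹ * (symHessCountAt ρ L μ y H G + (if H = G then (1 : ℚ) else 0) * ((d ! : ℚ) * symLinCountAt ρ L μ y H)))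
          + ((d ! : ℚ) * (L : ℚ) ^ d)⁻¹ * ((if H = G ∧ H.1 = α then (1 : ℚ) else 0) * symLinCountAt ρ L μ y H)
          + ((2 : ℚ) * ((d ! : ℚ) ^ 2 * (L : ℚ) ^ (2 * d)))⁻¹ * (symLinCountAt ρ L μ y G * symLinCountAt ρ L μ y H)) • E 0 2 := by
  rw [c11_symNR_of_single (Nat.cast_ne_zero.2 (Nat.factorial_ne_zero d)) hL two_ne_zero ρ hB' hB μ y, comm_E01_E12, comm_E12_E01]
  simp only [← Int.cast_smul_eq_zsmul ℚ, smul_mul_assoc, mul_smul_comm, E01_mul_E12, E12_mul_E01, smul_zero, zero_add]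
  by_cases hHG : H = G
  · by_cases hHa : H.1 = α
    · simp only [if_pos hHG, if_pos (show H = G ∧ H.1 = α from ⟨hHG, hHa⟩)]
      module
    · simp only [if_pos hHG, if_neg (show ¬(H = G ∧ H.1 = α) from fun h => hHa h.2)]
      module
  · simp only [if_neg hHG, if_neg (show ¬(H = G ∧ H.1 = α) from fun h => hHG h.1)]
    module

/-- [folklore] `X₀₀ = (ℓ⁻¹ Z_F) • E₂₃` (an1's sym `X00_of_single`). -/
theorem X00_E (hW : R1g α W = single F (E 2 3)) (B B' : Form1 d UT) (μ : Fin d) (y : Fin d → ℤ) :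
    c00 (symQjetAt ℚ ρ (R1g α (upF W)) (R1g α B) (R1g α B') L μ y) = (((d ! : ℚ) * (L : ℚ) ^ d)⁻¹ * symLinCountAt ρ L μ y F) • E 2 3 := by
  rw [X00_of_single (Nat.cast_ne_zero.2 (Nat.factorial_ne_zero d)) hL ρ hW B B' μ y, ← Int.cast_smul_eq_zsmul ℚ, smul_smul]

/-- [folklore] `X₀₁(B,B′) = ξ • E₁₃`, `ξ = −(2ℓ²)⁻¹ v(F,H) + ℓ⁻¹ χ_HF Z_F` (an1's sym `X01_of_single`, §1). -/
theorem X01_E (hW : R1g α W = single F (E 2 3)) (hB' : R1g α B' = single H (E 1 2)) (B : Form1 d UT) (μ : Fin d)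
    (y : Fin d → ℤ) :
    c01 (symQjetAt ℚ ρ (R1g α (upF W)) (R1g α B) (R1g α B') L μ y) + c00 (symQjetAt ℚ ρ (ad1R α (upF W) B') (R1g α B) (R1g α B') L μ y)
      = (-(((2 : ℚ) * ((d ! : ℚ) ^ 2 * (L : ℚ) ^ (2 * d)))⁻¹ * symVhCountAt ρ L μ y F H)
          + ((d ! : ℚ) * (L : ℚ) ^ d)⁻¹ * ((if F = H ∧ F.1 = α then (1 : ℚ) else 0) * symLinCountAt ρ L μ y F)) • E 1 3 := by
  rw [X01_of_single (Nat.cast_ne_zero.2 (Nat.factorial_ne_zero d)) hL two_ne_zero ρ hW hB' B μ y, comm_E23_E12, comm_E12_E23]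
  by_cases h : F = H ∧ F.1 = α
  · simp only [if_pos h]
    simp [← Int.cast_smul_eq_zsmul ℚ, smul_smul]
    module
  · simp only [if_neg h]
    simp [← Int.cast_smul_eq_zsmul ℚ, smul_smul]

/-- [folklore] `X₁₀(B,B′) = 0` for these letters (`[E₂₃, E₀₁] = [E₀₁, E₂₃] = 0`; an1's sym `X10_of_single`). -/
theorem X10_E (hW : R1g α W = single F (E 2 3)) (hB : R1g α B = single G (E 0 1)) (B' : Form1 d UT) (μ : Fin d)
    (y : Fin d → ℤ) :
    c10 (symQjetAt ℚ ρ (R1g α (upF W)) (R1g α B) (R1g α B') L μ y) + c00 (symQjetAt ℚ ρ (ad1R α (upF W) B) (R1g α B) (R1g α B') L μ y)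
      = 0 := by
  rw [X10_of_single (Nat.cast_ne_zero.2 (Nat.factorial_ne_zero d)) hL two_ne_zero ρ hW hB B' μ y, comm_E23_E01, comm_E01_E23]
  simp

/-- [folklore] `X₀₁(B′,B) = 0` (backgrounds in the other order). -/
theorem X01_E' (hW : R1g α W = single F (E 2 3)) (hB : R1g α B = single G (E 0 1)) (B' : Form1 d UT) (μ : Fin d)
    (y : Fin d → ℤ) :
    c01 (symQjetAt ℚ ρ (R1g α (upF W)) (R1g α B') (R1g α B) L μ y) + c00 (symQjetAt ℚ ρ (ad1R α (upF W) B) (R1g α B') (R1g α B) L μ y)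
      = 0 := by
  rw [X01_of_single (Nat.cast_ne_zero.2 (Nat.factorial_ne_zero d)) hL two_ne_zero ρ hW hB B' μ y, comm_E23_E01, comm_E01_E23]
  simp

/-- [folklore] `X₁₀(B′,B) = ξ • E₁₃` (backgrounds in the other order). -/
theorem X10_E' (hW : R1g α W = single F (E 2 3)) (hB' : R1g α B' = single H (E 1 2)) (B : Form1 d UT) (μ : Fin d)
    (y : Fin d → ℤ) :
    c10 (symQjetAt ℚ ρ (R1g α (upF W)) (R1g α B') (R1g α B) L μ y) + c00 (symQjetAt ℚ ρ (ad1R α (upF W) B') (R1g α B') (R1g α B) L μ y)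
      = (-(((2 : ℚ) * ((d ! : ℚ) ^ 2 * (L : ℚ) ^ (2 * d)))⁻¹ * symVhCountAt ρ L μ y F H)
          + ((d ! : ℚ) * (L : ℚ) ^ d)⁻¹ * ((if F = H ∧ F.1 = α then (1 : ℚ) else 0) * symLinCountAt ρ L μ y F)) • E 1 3 := by
  rw [X10_of_single (Nat.cast_ne_zero.2 (Nat.factorial_ne_zero d)) hL two_ne_zero ρ hW hB' B μ y, comm_E23_E12, comm_E12_E23]
  by_cases h : F = H ∧ F.1 = α
  · simp only [if_pos h]
    simp [← Int.cast_smul_eq_zsmul ℚ, smul_smul]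
    module
  · simp only [if_neg h]
    simp [← Int.cast_smul_eq_zsmul ℚ, smul_smul]

/-- [folklore] THE ENTRY `symCT(B,B′)₀₃ = −(2ℓ²)⁻¹ χ_HF v(F,G)` (an1's `symCT_of_single`, §1). -/
theorem symCT_entry (hW : R1g α W = single F (E 2 3)) (hB : R1g α B = single G (E 0 1)) (hB' : R1g α B' = single H (E 1 2))
    (μ : Fin d) (y : Fin d → ℤ) :
    symCT ℚ ρ α (upF W) B B' L μ y 0 3
      = -(((2 : ℚ) * ((d ! : ℚ) ^ 2 * (L : ℚ) ^ (2 * d)))⁻¹ * ((if F = H ∧ F.1 = α then (1 : ℚ) else 0) * symVhCountAt ρ L μ y F G)) := by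
  rw [symCT_of_single (Nat.cast_ne_zero.2 (Nat.factorial_ne_zero d)) hL two_ne_zero ρ hW hB hB' μ y, comm_E01_E23, comm_E12_E23]
  by_cases h : F = H ∧ F.1 = α
  · simp only [if_pos h]
    simp [AveragingHessianKernels.comm, E, ← Int.cast_smul_eq_zsmul ℚ]
  · simp only [if_neg h]
    simp [AveragingHessianKernels.comm]

/-- [folklore] THE ENTRY `symCT(B′,B)₀₃ = −(2ℓ²)⁻¹ χ_HF v(F,G) + ℓ⁻¹ χ_GF χ_HF Z_F`. -/
theorem symCT_entry' (hW : R1g α W = single F (E 2 3)) (hB : R1g α B = single G (E 0 1)) (hB' : R1g α B' = single H (E 1 2))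
    (μ : Fin d) (y : Fin d → ℤ) :
    symCT ℚ ρ α (upF W) B' B L μ y 0 3
      = -(((2 : ℚ) * ((d ! : ℚ) ^ 2 * (L : ℚ) ^ (2 * d)))⁻¹ * ((if F = H ∧ F.1 = α then (1 : ℚ) else 0) * symVhCountAt ρ L μ y F G))
        + ((d ! : ℚ) * (L : ℚ) ^ d)⁻¹
          * ((if F = G ∧ F.1 = α then (1 : ℚ) else 0) * (if F = H ∧ F.1 = α then (1 : ℚ) else 0) * symLinCountAt ρ L μ y F) := by
  rw [symCT_of_single (Nat.cast_ne_zero.2 (Nat.factorial_ne_zero d)) hL two_ne_zero ρ hW hB' hB μ y, comm_E01_E23, comm_E12_E23]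
  by_cases hH : F = H ∧ F.1 = α
  · by_cases hG : F = G ∧ F.1 = α
    · simp only [if_pos hH, if_pos hG, if_pos (show F = H ∧ F = G ∧ F.1 = α from ⟨hH.1, hG.1, hH.2⟩)]
      simp [AveragingHessianKernels.comm, E, ← Int.cast_smul_eq_zsmul ℚ]
    · simp only [if_pos hH, if_neg hG, if_neg (show ¬(F = H ∧ F = G ∧ F.1 = α) from fun h => hG ⟨h.2.1, h.2.2⟩)]
      simp [AveragingHessianKernels.comm, E, ← Int.cast_smul_eq_zsmul ℚ]
  · simp only [if_neg hH, if_neg (show ¬(F = H ∧ F = G ∧ F.1 = α) from fun h => hH ⟨h.1, h.2.2⟩)]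
    simp [AveragingHessianKernels.comm]

/-- [folklore] THE ENTRY `symCJ(B,B′)₀₃` (an1's `symCJ` written out, §2 components, words evaluated in the path algebra). -/
theorem symCJ_entry (hW : R1g α W = single F (E 2 3)) (hB : R1g α B = single G (E 0 1)) (hB' : R1g α B' = single H (E 1 2))
    (μ : Fin d) (y : Fin d → ℤ) :
    symCJ ℚ ρ α (upF W) B B' L μ y 0 3
      = ((d ! : ℚ) * (L : ℚ) ^ d)⁻¹ * symLinCountAt ρ L μ y G
            * ((((2 : ℚ) * ((d ! : ℚ) ^ 2 * (L : ℚ) ^ (2 * d)))⁻¹ * symVhCountAt ρ L μ y F H)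
                - ((d ! : ℚ) * (L : ℚ) ^ d)⁻¹ * ((if F = H ∧ F.1 = α then (1 : ℚ) else 0) * symLinCountAt ρ L μ y F))
        - ((d ! : ℚ) * (L : ℚ) ^ d)⁻¹ * symLinCountAt ρ L μ y F
            * (((2 : ℚ) * ((d ! : ℚ) ^ 2 * (L : ℚ) ^ d))⁻¹ * (symHessCountAt ρ L μ y G H + (if G = H then (1 : ℚ) else 0) * ((d ! : ℚ) * symLinCountAt ρ L μ y G))
                - ((d ! : ℚ) * (L : ℚ) ^ d)⁻¹ * ((if G = H ∧ G.1 = α then (1 : ℚ) else 0) * symLinCountAt ρ L μ y G)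
                + ((2 : ℚ) * ((d ! : ℚ) ^ 2 * (L : ℚ) ^ (2 * d)))⁻¹ * (symLinCountAt ρ L μ y G * symLinCountAt ρ L μ y H))
        + (((d ! : ℚ) * (L : ℚ) ^ d)⁻¹) ^ 3 * symLinCountAt ρ L μ y F * symLinCountAt ρ L μ y G * symLinCountAt ρ L μ y H := by
  rw [symCJ, X01_E hL ρ hW hB' B μ y, X10_E hL ρ hW hB B' μ y, X00_E hL ρ hW B B' μ y, c10_symNR_E hL ρ hB B' μ y,
    c01_symNR_E hL ρ hB' B μ y, c11_symNR_E hL ρ hB hB' μ y]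
  simp [E]
  ring

/-- [folklore] THE ENTRY `symCJ(B′,B)₀₃` (backgrounds in the other order). -/
theorem symCJ_entry' (hW : R1g α W = single F (E 2 3)) (hB : R1g α B = single G (E 0 1)) (hB' : R1g α B' = single H (E 1 2))
    (μ : Fin d) (y : Fin d → ℤ) :
    symCJ ℚ ρ α (upF W) B' B L μ y 0 3
      = ((d ! : ℚ) * (L : ℚ) ^ d)⁻¹ * symLinCountAt ρ L μ y G
            * ((((2 : ℚ) * ((d ! : ℚ) ^ 2 * (L : ℚ) ^ (2 * d)))⁻¹ * symVhCountAt ρ L μ y F H)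
                - ((d ! : ℚ) * (L : ℚ) ^ d)⁻¹ * ((if F = H ∧ F.1 = α then (1 : ℚ) else 0) * symLinCountAt ρ L μ y F))
        - ((d ! : ℚ) * (L : ℚ) ^ d)⁻¹ * symLinCountAt ρ L μ y F
            * (-(((2 : ℚ) * ((d ! : ℚ) ^ 2 * (L : ℚ) ^ d))⁻¹ * (symHessCountAt ρ L μ y H G + (if H = G then (1 : ℚ) else 0) * ((d ! : ℚ) * symLinCountAt ρ L μ y H)))
                + ((d ! : ℚ) * (L : ℚ) ^ d)⁻¹ * ((if H = G ∧ H.1 = α then (1 : ℚ) else 0) * symLinCountAt ρ L μ y H)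
                + ((2 : ℚ) * ((d ! : ℚ) ^ 2 * (L : ℚ) ^ (2 * d)))⁻¹ * (symLinCountAt ρ L μ y G * symLinCountAt ρ L μ y H))
        + (((d ! : ℚ) * (L : ℚ) ^ d)⁻¹) ^ 3 * symLinCountAt ρ L μ y F * symLinCountAt ρ L μ y G * symLinCountAt ρ L μ y H := by
  rw [symCJ, X01_E' hL ρ hW hB B' μ y, X10_E' hL ρ hW hB' B μ y, X00_E hL ρ hW B' B μ y, c10_symNR_E hL ρ hB' B μ y,
    c01_symNR_E hL ρ hB B' μ y, c11_symNR_E' hL ρ hB hB' μ y]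
  simp [E]
  ring

end Pieces

/-! ## §3 The per-ordering ℚ law of the sym border table -/

/-- [folklore] **THE BORDER TABLE UNDER THE REFLECTION OF AXIS `α`, ONE ORDERING OF THE BACKGROUNDS** (an1's `SymRootedT2JetSingle.symT2At_bref` at the
signed single letters, `symT2At_upF_single_signs`, the comb `R1g_single_signed`, §2's entries; `f♯ = fref α f`):
sym shape with constants per BCH order: `ℓ⁻¹ = (d!L^d)⁻¹` on every `q_sym`, `((d!)²L^{2d})⁻¹` on the `v_sym` contact, and `(d!)⁻³L^{-2d}` on the
`(g,h)`-ODD term `q_sym(f♯) h_sym(g♯,h♯)`.  The `(g,h)`-ODD term `−ℓ⁻² Z h(g♯,h♯)` is why only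
the `(g,h)`-symmetrised law (§4) is the one of BX2. -/
theorem symVh2Tab_bref {d L : ℕ} (hL : Odd L) (α μ : Fin d) (f g h : Bond d) (y : Fin d → ℤ) :
    symVh2Tab (ctr d L) L μ (bref α μ y) f g h
      = ((if μ = α then -1 else 1 : ℚ)
          * ((if f.1 = α then -1 else 1 : ℚ) * (if g.1 = α then -1 else 1 : ℚ) * (if h.1 = α then -1 else 1 : ℚ)))
        * (symVh2Tab (ctr d L) L μ y (fref α f) (fref α g) (fref α h)
            - (((d ! : ℚ) ^ 2 * (L : ℚ) ^ (2 * d)))⁻¹ * ((if fref α f = fref α h ∧ f.1 = α then (1 : ℚ) else 0)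
                * symVhCountAt (ctr d L) L μ y (fref α f) (fref α g))
            + ((d ! : ℚ) * (L : ℚ) ^ d)⁻¹ * ((if fref α f = fref α g ∧ f.1 = α then (1 : ℚ) else 0)
                * (if fref α f = fref α h ∧ f.1 = α then (1 : ℚ) else 0) * symLinCountAt (ctr d L) L μ y (fref α f))
            + (if μ = α then
                (((d ! : ℚ) * (L : ℚ) ^ d)⁻¹) ^ 3 * symLinCountAt (ctr d L) L μ y (fref α g) * symVhCountAt (ctr d L) L μ y (fref α f) (fref α h)
                  - 2 * (((d ! : ℚ) * (L : ℚ) ^ d)⁻¹) ^ 2 * ((if fref α f = fref α h ∧ f.1 = α then (1 : ℚ) else 0)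
                      * symLinCountAt (ctr d L) L μ y (fref α f) * symLinCountAt (ctr d L) L μ y (fref α g))
                  - (((d ! : ℚ) * (L : ℚ) ^ d)⁻¹) ^ 2 * (d ! : ℚ)⁻¹ * symLinCountAt (ctr d L) L μ y (fref α f) * symHessCountAt (ctr d L) L μ y (fref α g) (fref α h)
                  + (((d ! : ℚ) * (L : ℚ) ^ d)⁻¹) ^ 3 * symLinCountAt (ctr d L) L μ y (fref α f) * symLinCountAt (ctr d L) L μ y (fref α g)
                      * symLinCountAt (ctr d L) L μ y (fref α h)
               else 0)) := by
  have hL0 : (L : ℚ) ≠ 0 := Nat.cast_ne_zero.2 hL.pos.ne'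
  have hd : (d ! : ℚ) ≠ 0 := Nat.cast_ne_zero.2 (Nat.factorial_ne_zero d)
  have hW : R1g α (single f (if f.1 = α then -E 2 3 else E 2 3)) = single (fref α f) (E 2 3) := R1g_single_signed α f (E 2 3)
  have hB : R1g α (single g (if g.1 = α then -E 0 1 else E 0 1)) = single (fref α g) (E 0 1) := R1g_single_signed α g (E 0 1)
  have hB' : R1g α (single h (if h.1 = α then -E 1 2 else E 1 2)) = single (fref α h) (E 1 2) := R1g_single_signed α h (E 1 2)
  have law := symT2At_bref ℚ hL two_ne_zero α μ (upF (single f (if f.1 = α then -E 2 3 else E 2 3)))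
    (single g (if g.1 = α then -E 0 1 else E 0 1)) (single h (if h.1 = α then -E 1 2 else E 1 2)) y
  rw [R1g_upF, hW, hB, hB', symT2At_upF_single_signs] at law
  have sq : ((if f.1 = α then -1 else 1 : ℚ) * (if g.1 = α then -1 else 1 : ℚ) * (if h.1 = α then -1 else 1 : ℚ))
      * ((if f.1 = α then -1 else 1 : ℚ) * (if g.1 = α then -1 else 1 : ℚ) * (if h.1 = α then -1 else 1 : ℚ)) = 1 := by
    split_ifs <;> norm_num
  simp only [symVh2Tab]
  by_cases hμ : μ = α
  · rw [if_pos hμ, if_pos hμ] at law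
    have e := congrArg (fun M : UT => M 0 3) law
    simp only [Matrix.smul_apply, Matrix.add_apply, zsmul_eq_mul] at e
    push_cast at e
    rw [symCT_entry hL0 _ hW hB hB', symCT_entry' hL0 _ hW hB hB', symCJ_entry hL0 _ hW hB hB', symCJ_entry' hL0 _ hW hB hB'] at e
    simp only [fref_fst] at e
    have e' := congrArg
      (fun t => ((if f.1 = α then -1 else 1 : ℚ) * (if g.1 = α then -1 else 1 : ℚ) * (if h.1 = α then -1 else 1 : ℚ)) * t) e
    rw [← mul_assoc, sq, one_mul] at e'
    rw [e', if_pos hμ, if_pos hμ]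
    by_cases hGH : fref α g = fref α h
    · obtain rfl : g = h := fref_injective α hGH
      simp only [if_pos trivial, true_and, symHessCountAt_self]
      ring
    · have hHG : ¬fref α h = fref α g := fun e => hGH e.symm
      simp only [if_neg hGH, if_neg hHG, if_neg (show ¬(fref α g = fref α h ∧ g.1 = α) from fun hh => hGH hh.1),
        if_neg (show ¬(fref α h = fref α g ∧ h.1 = α) from fun hh => hHG hh.1),
        symHessCountAt_swap (ctr d L) L μ y (fref α g) (fref α h)]
      push_cast
      ring
  · rw [if_neg hμ, if_neg hμ, add_zero] at law
    have e := congrArg (fun M : UT => M 0 3) law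
    simp only [Matrix.smul_apply, Matrix.add_apply, zsmul_eq_mul] at e
    push_cast at e
    rw [symCT_entry hL0 _ hW hB hB', symCT_entry' hL0 _ hW hB hB'] at e
    simp only [fref_fst] at e
    have e' := congrArg
      (fun t => ((if f.1 = α then -1 else 1 : ℚ) * (if g.1 = α then -1 else 1 : ℚ) * (if h.1 = α then -1 else 1 : ℚ)) * t) e
    rw [← mul_assoc, sq, one_mul] at e'
    rw [e', if_neg hμ, if_neg hμ]
    ring

/-! ## §4 The bond-level sym border law in kernel currency (`contact_iff'` BY NAME) -/

variable {Lc : ℕ}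

set_option maxHeartbeats 1600000 in -- 2⁹ sign∕contact branches × `ring` with the extra `d!` atoms (the comb proof sits just under the default budget)
open Classical in
/-- [folklore] **an1's `(g,h)`-SYMMETRISED BOND-LEVEL BORDER REFLECTION LAW OF THE SYM BORDER KERNEL** — the SAME outer shape as the comb
`RootedBorderTableLaw.bondLaw` (the hypothesis `hB` of BX2 `BorderLetterPacking.borderInv_of_bondLaw` ∕ `hBb` of RX) with the sym kernels,
for the SYM kernels at root `ctr 4 Lc`, for every odd `Lc` (§3 at `d = 4` for both orderings of the backgrounds,
`h(G,H) = −h(H,G)`, casts `ℚ → ℝ`). -/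
theorem symBondLaw (hLc : Odd Lc) :
    ∀ (α m : Fin 4) (y : Fin 4 → ℤ) (β : Fin 4) (x : Fin 4 → ℤ) (κ : Fin 4) (u : Fin 4 → ℤ) (κ' : Fin 4) (u' : Fin 4 → ℤ),
      reflSign α β * reflSign α κ * reflSign α κ' * reflSign α m *
          (symVh2KerAt (ctr 4 Lc) Lc m (bref α m y) (β, bref α β x) (κ, bref α κ u) (κ', bref α κ' u')
            + symVh2KerAt (ctr 4 Lc) Lc m (bref α m y) (β, bref α β x) (κ', bref α κ' u') (κ, bref α κ u))
        = (symVh2KerAt (ctr 4 Lc) Lc m y (β, x) (κ, u) (κ', u') + symVh2KerAt (ctr 4 Lc) Lc m y (β, x) (κ', u') (κ, u))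
          + 2 * (symVhKerAt (ctr 4 Lc) Lc m y (β, x) (κ', u')
                  * ((if m = α then symLinKerAt (ctr 4 Lc) Lc m y (κ, u) else 0) - (if x = u ∧ β = κ ∧ κ = α then 1 else 0))
                + symVhKerAt (ctr 4 Lc) Lc m y (β, x) (κ, u)
                  * ((if m = α then symLinKerAt (ctr 4 Lc) Lc m y (κ', u') else 0) - (if x = u' ∧ β = κ' ∧ κ' = α then 1 else 0))
                + symLinKerAt (ctr 4 Lc) Lc m y (β, x)
                  * ((if m = α then symLinKerAt (ctr 4 Lc) Lc m y (κ, u) else 0) - (if x = u ∧ β = κ ∧ κ = α then 1 else 0))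
                  * ((if m = α then symLinKerAt (ctr 4 Lc) Lc m y (κ', u') else 0) - (if x = u' ∧ β = κ' ∧ κ' = α then 1 else 0))) := by
  intro α m y β x κ u κ' u'
  have e1 := symVh2Tab_bref (d := 4) hLc α m (β, bref α β x) (κ, bref α κ u) (κ', bref α κ' u') y
  have e2 := symVh2Tab_bref (d := 4) hLc α m (β, bref α β x) (κ', bref α κ' u') (κ, bref α κ u) y
  simp only [fref_mk, bref_bref, contact_iff'] at e1 e2
  simp only [symVh2KerAt, symVhKerAt, symLinKerAt, reflSign, e1, e2, symHessCountAt_swap (ctr 4 Lc) Lc m y (κ, u) (κ', u')]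
  split_ifs <;> push_cast <;> ring

end Summit.QuantumFields.BalabanUV.Beta.SymRootedBorderTableLaw
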